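import Summits.RiemannHypothesis.RiemannHypothesis.Theorems.UniversalFactorNarrowKernelNoGoEnergyLowerRemainder
import Mathlib.MeasureTheory.Integral.Prod

/-!
# RiemannHypothesis / UniversalFactor — `NarrowKernelNoGo` (stmt-RiemannHypothesis-2576), line `Sketch`:
# stub K1a-reduction, part 2 — `UniversalFactor.stub_narrowEnergyLowerReduction`

Route `RiemannHypothesis/UniversalFactor`, crux `NarrowKernelNoGo`. Notation as in part 1
(`UniversalFactorNarrowKernelNoGoEnergyLowerRemainder.lean`): `E(τ) = ‖γ(1/2 + iτ)‖`, `Z = hardyZ`,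
`w(t) = t^{-7/4} e^{πt/4}`, `κ_a(u) = e^{−2a|u|} e^{−πu/4}`, `I₀(t) = ∫ e^{−2a|u|} E(t+u) Z(t+u) du`,
`g(t) = ∫ κ_a(u) Z(t+u) du`, `r = I₀ w − c₀ g`.

The registered stub says: the CLEAN lower bound `∫_T^{2T} g² ≥ c₁ T` and the `ξ`-envelope facts
(`E(t+u) w(t) = c₀ e^{−πu/4} + O(e^{−πu/4}(1+|u|)/t)` for `|u| ≤ t/2`, `E(τ) ≪ (1+|τ|)^{7/4}e^{−π|τ|/4}`)
imply `∫_T^{2T} (I₀ w)² ≥ c T`. Proof: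

* Step 1 (part 1): `|r(t)| ≤ (D/t) ∫ (1+|u|)⁴ κ_a(u) |Z(t+u)| du` for `t ≥ max(T₀, 1)`.
* Step 2 (`UniversalFactor.narrowRed_fubini_bound`, `UniversalFactor.narrowRed_remainder_meanSquare`):
  `|r| ≤ 4DK₅` (`|Z(τ)| ≤ 2 + 2|τ|`) and `|r(t)| ≤ (D/T)(K₄ + ∫ (1+|u|)⁴κ_a(u) Z(t+u)² du)`
  (`|Z| ≤ 1 + Z²`), so by Tonelli and the crude shifted mean square of `Z`,
  `∫_T^{2T} r² ≤ D²(A + B(1 + log 2T)³) = o(T)` (`UniversalFactor.narrowRed_log_cube_eventually`).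
* Step 3: `(c₀ g + r)² ≥ c₀² g²/2 − r²`, integrate: `∫(I₀w)² ≥ (c₀²/2)c₁T − (c₀²c₁/4)T`.

References: Titchmarsh, *The Theory of the Riemann Zeta-Function* (1986), §7.2–7.3.
-/

noncomputable section

-- D-0017: `Summit.<S>.<S>.…` is the designed namespace of a single-problem summit.
set_option linter.dupNamespace false

namespace Summit.RiemannHypothesis.RiemannHypothesis.Theorems

open MeasureTheory Set Filter Complex intervalIntegral
open scoped Real Topology
open Literature.NumberTheory.LFunctions

-- the tilted kernel `κ_a(u) = e^{−2a|u|} e^{−πu/4}` (local notation of this file)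
local notation "KT(" a ", " u ")" => Real.exp (-(2 * a * |u|)) * Real.exp (-(π * u / 4))

/-! ## Step 2: the mean square of the remainder -/

/-- **Tonelli step.** For `T ≥ 1`, `t ↦ ∫ (1+|u|)⁴ κ_a(u) Z(t+u)² du` is integrable on `[T, 2T]` and
`∫_T^{2T} ∫ℝ (1+|u|)⁴ κ_a(u) Z(t+u)² du dt ≤ B (1 + 2T)(1 + log 2T)³` (swap the integrals — the
integrand is continuous and nonnegative, the `u`-marginal is dominated by `(1+|u|)⁸ κ_a` — and use the
shifted crude mean square of `Z`). [folklore] -/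
theorem UniversalFactor.narrowRed_fubini_bound {a : ℝ} (ha : π / 8 < a) :
    ∃ B : ℝ, 0 ≤ B ∧ ∀ T : ℝ, 1 ≤ T →
      IntervalIntegrable (fun t : ℝ => ∫ u : ℝ, (1 + |u|) ^ 4 * KT(a, u) * hardyZ (t + u) ^ 2)
        volume T (2 * T) ∧
      ∫ t in T..2 * T, (∫ u : ℝ, (1 + |u|) ^ 4 * KT(a, u) * hardyZ (t + u) ^ 2) ≤
        B * (1 + 2 * T) * (1 + Real.log (2 * T)) ^ 3 := by
  obtain ⟨Cζ, hCζ, hms⟩ := UniversalFactor.narrowRed_hardyZ_meanSquare_shift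
  have hK₈ := UniversalFactor.narrow_integrable_pow_mul_ker ha 8
  set K₈ : ℝ := ∫ u : ℝ, (1 + |u|) ^ 8 * KT(a, u) with hK₈def
  have hK₈0 : 0 ≤ K₈ := integral_nonneg fun u => by positivity
  refine ⟨Cζ * K₈, by positivity, fun T hT => ?_⟩
  have hT2 : T ≤ 2 * T := by linarith
  set L : ℝ := Cζ * (1 + 2 * T) * (1 + Real.log (2 * T)) ^ 3 with hL
  have hlog : 0 ≤ Real.log (2 * T) := Real.log_nonneg (by linarith)
  have hL0 : 0 ≤ L := by positivity
  set μ : Measure ℝ := volume.restrict (Ioc T (2 * T)) with hμ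
  set Φ : ℝ → ℝ → ℝ := fun t u => (1 + |u|) ^ 4 * KT(a, u) * hardyZ (t + u) ^ 2 with hΦ
  have hZc := continuous_hardyZ
  have hΦc : Continuous (Function.uncurry Φ) := by
    have h1 : Continuous fun p : ℝ × ℝ => hardyZ (p.1 + p.2) :=
      hZc.comp (continuous_fst.add continuous_snd)
    exact ((by fun_prop : Continuous fun p : ℝ × ℝ => (1 + |p.2|) ^ 4 * KT(a, p.2))).fun_mul
      (h1.fun_pow 2)
  have hΦn : ∀ t u, 0 ≤ Φ t u := fun t u => by positivity
  -- the `u`-marginal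
  have key : ∀ u : ℝ, ∫ t, Φ t u ∂μ ≤ L * ((1 + |u|) ^ 8 * KT(a, u)) := fun u => by
    have hκ := UniversalFactor.narrowKer_pos a u
    calc ∫ t, Φ t u ∂μ = ∫ t in T..2 * T, Φ t u := (intervalIntegral.integral_of_le hT2).symm
      _ = (1 + |u|) ^ 4 * KT(a, u) * ∫ t in T..2 * T, hardyZ (t + u) ^ 2 :=
          intervalIntegral.integral_const_mul _ _
      _ ≤ (1 + |u|) ^ 4 * KT(a, u) *
            (Cζ * (1 + 2 * T) * (1 + Real.log (2 * T)) ^ 3 * (1 + |u|) ^ 4) :=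
          mul_le_mul_of_nonneg_left (hms T hT u) (by positivity)
      _ = L * ((1 + |u|) ^ 8 * KT(a, u)) := by rw [hL]; ring
  have hint : Integrable (Function.uncurry Φ) (μ.prod volume) := by
    refine (integrable_prod_iff' hΦc.aestronglyMeasurable).2 ⟨?_, ?_⟩
    · refine Eventually.of_forall fun u => ?_
      have h1 : Continuous fun t : ℝ => Φ t u := by
        have h2 : Continuous fun t : ℝ => hardyZ (t + u) := hZc.comp (continuous_id.add continuous_const)
        exact continuous_const.fun_mul (h2.fun_pow 2)
      exact h1.integrableOn_Ioc
    · have hmeas : AEStronglyMeasurable (fun u : ℝ => ∫ t, ‖Function.uncurry Φ (t, u)‖ ∂μ) volume := by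
        have h1 : Continuous fun p : ℝ × ℝ => ‖Function.uncurry Φ (p.2, p.1)‖ :=
          (hΦc.comp (continuous_snd.prodMk continuous_fst)).norm
        exact (h1.aestronglyMeasurable (μ := (volume : Measure ℝ).prod μ)).integral_prod_right'
      refine ((hK₈.const_mul L).mono' hmeas (Eventually.of_forall fun u => ?_))
      rw [Real.norm_of_nonneg (integral_nonneg fun t => norm_nonneg _)]
      have h2 : ∫ t, ‖Function.uncurry Φ (t, u)‖ ∂μ = ∫ t, Φ t u ∂μ :=
        integral_congr_ae (Eventually.of_forall fun t => Real.norm_of_nonneg (hΦn t u))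
      rw [h2]
      exact key u
  refine ⟨(intervalIntegrable_iff_integrableOn_Ioc_of_le hT2).2 hint.integral_prod_left, ?_⟩
  calc ∫ t in T..2 * T, ∫ u, Φ t u = ∫ t, ∫ u, Φ t u ∂volume ∂μ := intervalIntegral.integral_of_le hT2
    _ = ∫ u, ∫ t, Φ t u ∂μ := integral_integral_swap hint
    _ ≤ ∫ u, L * ((1 + |u|) ^ 8 * KT(a, u)) :=
        integral_mono hint.integral_prod_right (hK₈.const_mul L) key
    _ = L * K₈ := MeasureTheory.integral_const_mul _ _
    _ = Cζ * K₈ * (1 + 2 * T) * (1 + Real.log (2 * T)) ^ 3 := by rw [hL]; ring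

/-- **Mean square of the remainder.** If `r` is continuous on `[T, 2T]` (`T ≥ 1`) with
`|r(t)| ≤ (D/t) ∫ (1+|u|)⁴ κ_a(u) |Z(t+u)| du` there, then `∫_T^{2T} r² ≤ D²(A + B(1 + log 2T)³)`
with `A, B` depending only on `a`: pointwise `|r| ≤ 4 D K₅` (`|Z(τ)| ≤ 2 + 2|τ|`) and
`|r(t)| ≤ (D/T)(K₄ + ∫ (1+|u|)⁴κ_a Z(t+u)²)` (`|Z| ≤ 1 + Z²`), then the Tonelli step. [folklore] -/
theorem UniversalFactor.narrowRed_remainder_meanSquare {a : ℝ} (ha : π / 8 < a) :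
    ∃ A B : ℝ, ∀ (D T : ℝ) (r : ℝ → ℝ), 0 ≤ D → 1 ≤ T → ContinuousOn r (Icc T (2 * T)) →
      (∀ t ∈ Icc T (2 * T), |r t| ≤ D / t * ∫ u : ℝ, (1 + |u|) ^ 4 * KT(a, u) * |hardyZ (t + u)|) →
      ∫ t in T..2 * T, r t ^ 2 ≤ D ^ 2 * (A + B * (1 + Real.log (2 * T)) ^ 3) := by
  obtain ⟨B, hB0, hB⟩ := UniversalFactor.narrowRed_fubini_bound ha
  have hK₄ := UniversalFactor.narrow_integrable_pow_mul_ker ha 4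
  have hK₅ := UniversalFactor.narrow_integrable_pow_mul_ker ha 5
  set K₄ : ℝ := ∫ u : ℝ, (1 + |u|) ^ 4 * KT(a, u) with hK₄def
  set K₅ : ℝ := ∫ u : ℝ, (1 + |u|) ^ 5 * KT(a, u) with hK₅def
  have hK₄0 : 0 ≤ K₄ := integral_nonneg fun u => by positivity
  have hK₅0 : 0 ≤ K₅ := integral_nonneg fun u => by positivity
  refine ⟨4 * K₅ * K₄, 4 * K₅ * (3 * B), fun D T r hD hT hr hbound => ?_⟩
  obtain ⟨hFint, hFle⟩ := hB T hT
  have hT0 : 0 < T := by linarith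
  have hT2 : T ≤ 2 * T := by linarith
  have hlog : 0 ≤ Real.log (2 * T) := Real.log_nonneg (by linarith)
  have habsZ : ∀ τ : ℝ, |(|hardyZ τ|)| ≤ 2 * (1 + |τ|) ^ 1 := fun τ => by
    rw [abs_abs]; exact UniversalFactor.narrowRed_abs_hardyZ_le τ
  -- pointwise bound for `r²`
  have hpt : ∀ t ∈ Icc T (2 * T), r t ^ 2 ≤
      D ^ 2 * (4 * K₅) / T * (K₄ + ∫ u : ℝ, (1 + |u|) ^ 4 * KT(a, u) * hardyZ (t + u) ^ 2) := by
    intro t ht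
    have ht1 : 1 ≤ t := hT.trans ht.1
    have ht0 : 0 < t := by linarith
    have h1 := hbound t ht
    have hiZ := UniversalFactor.narrowRed_integrable_section ha (φ := fun τ => |hardyZ τ|)
      (continuous_abs.comp continuous_hardyZ) habsZ 4 t
    have hiZ2 := UniversalFactor.narrowRed_integrable_section ha (φ := fun τ => hardyZ τ ^ 2)
      (continuous_hardyZ.fun_pow 2) UniversalFactor.narrowRed_hardyZ_sq_le 4 t
    -- (i) `∫ (1+|u|)⁴ κ |Z(t+u)| ≤ (2 + 2t) K₅`
    have hi : ∫ u : ℝ, (1 + |u|) ^ 4 * KT(a, u) * |hardyZ (t + u)| ≤ (2 + 2 * t) * K₅ := by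
      rw [hK₅def, ← MeasureTheory.integral_const_mul]
      refine integral_mono hiZ (hK₅.const_mul _) fun u => ?_
      have hκ := UniversalFactor.narrowKer_pos a u
      have hu : 0 ≤ |u| := abs_nonneg u
      have h2 : |hardyZ (t + u)| ≤ (2 + 2 * t) * (1 + |u|) := by
        have h3 := UniversalFactor.narrowRed_abs_hardyZ_le (t + u)
        have h4 := abs_add_le t u
        rw [abs_of_pos ht0] at h4
        rw [pow_one] at h3
        nlinarith
      calc (1 + |u|) ^ 4 * KT(a, u) * |hardyZ (t + u)|
          ≤ (1 + |u|) ^ 4 * KT(a, u) * ((2 + 2 * t) * (1 + |u|)) :=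
            mul_le_mul_of_nonneg_left h2 (by positivity)
        _ = (2 + 2 * t) * ((1 + |u|) ^ 5 * KT(a, u)) := by ring
    -- (ii) `∫ (1+|u|)⁴ κ |Z(t+u)| ≤ K₄ + ∫ (1+|u|)⁴ κ Z(t+u)²`
    have hii : ∫ u : ℝ, (1 + |u|) ^ 4 * KT(a, u) * |hardyZ (t + u)| ≤
        K₄ + ∫ u : ℝ, (1 + |u|) ^ 4 * KT(a, u) * hardyZ (t + u) ^ 2 := by
      rw [hK₄def, ← integral_add hK₄ hiZ2]
      refine integral_mono hiZ (hK₄.add hiZ2) fun u => ?_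
      have hκ : 0 ≤ (1 + |u|) ^ 4 * KT(a, u) := by positivity
      have h2 : |hardyZ (t + u)| ≤ 1 + hardyZ (t + u) ^ 2 := by
        have := sq_abs (hardyZ (t + u))
        nlinarith [sq_nonneg (|hardyZ (t + u)| - 1)]
      calc (1 + |u|) ^ 4 * KT(a, u) * |hardyZ (t + u)|
          ≤ (1 + |u|) ^ 4 * KT(a, u) * (1 + hardyZ (t + u) ^ 2) := mul_le_mul_of_nonneg_left h2 hκ
        _ = (1 + |u|) ^ 4 * KT(a, u) + (1 + |u|) ^ 4 * KT(a, u) * hardyZ (t + u) ^ 2 := by ring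
    have hr1 : |r t| ≤ D * (4 * K₅) := by
      calc |r t| ≤ D / t * ((2 + 2 * t) * K₅) := h1.trans (mul_le_mul_of_nonneg_left hi (by positivity))
        _ = D * ((2 + 2 * t) / t) * K₅ := by ring
        _ ≤ D * 4 * K₅ := by
            refine mul_le_mul_of_nonneg_right (mul_le_mul_of_nonneg_left ?_ hD) hK₅0
            rw [div_le_iff₀ ht0]; linarith
        _ = D * (4 * K₅) := by ring
    have hr2 : |r t| ≤ D / T * (K₄ + ∫ u : ℝ, (1 + |u|) ^ 4 * KT(a, u) * hardyZ (t + u) ^ 2) := by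
      have hF0 : 0 ≤ ∫ u : ℝ, (1 + |u|) ^ 4 * KT(a, u) * hardyZ (t + u) ^ 2 :=
        integral_nonneg fun u => by positivity
      calc |r t| ≤ D / t * (K₄ + ∫ u : ℝ, (1 + |u|) ^ 4 * KT(a, u) * hardyZ (t + u) ^ 2) :=
            h1.trans (mul_le_mul_of_nonneg_left hii (by positivity))
        _ ≤ D / T * (K₄ + ∫ u : ℝ, (1 + |u|) ^ 4 * KT(a, u) * hardyZ (t + u) ^ 2) :=
            mul_le_mul_of_nonneg_right (div_le_div_of_nonneg_left hD hT0 ht.1) (by positivity)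
    calc r t ^ 2 = |r t| * |r t| := by rw [← sq_abs, sq]
      _ ≤ (D * (4 * K₅)) * (D / T * (K₄ + ∫ u : ℝ, (1 + |u|) ^ 4 * KT(a, u) * hardyZ (t + u) ^ 2)) :=
          mul_le_mul hr1 hr2 (abs_nonneg _) (by positivity)
      _ = D ^ 2 * (4 * K₅) / T * (K₄ + ∫ u : ℝ, (1 + |u|) ^ 4 * KT(a, u) * hardyZ (t + u) ^ 2) := by
          ring
  -- integrate over `[T, 2T]`
  have hri : IntervalIntegrable (fun t => r t ^ 2) volume T (2 * T) :=
    (hr.fun_pow 2).intervalIntegrable_of_Icc hT2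
  have hRi : IntervalIntegrable (fun t => D ^ 2 * (4 * K₅) / T *
      (K₄ + ∫ u : ℝ, (1 + |u|) ^ 4 * KT(a, u) * hardyZ (t + u) ^ 2)) volume T (2 * T) :=
    (intervalIntegrable_const.add hFint).const_mul _
  calc ∫ t in T..2 * T, r t ^ 2
      ≤ ∫ t in T..2 * T, D ^ 2 * (4 * K₅) / T *
          (K₄ + ∫ u : ℝ, (1 + |u|) ^ 4 * KT(a, u) * hardyZ (t + u) ^ 2) :=
        intervalIntegral.integral_mono_on hT2 hri hRi hpt
    _ = D ^ 2 * (4 * K₅) / T * (K₄ * (2 * T - T) +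
          ∫ t in T..2 * T, ∫ u : ℝ, (1 + |u|) ^ 4 * KT(a, u) * hardyZ (t + u) ^ 2) := by
        rw [intervalIntegral.integral_const_mul, intervalIntegral.integral_add intervalIntegrable_const hFint,
          intervalIntegral.integral_const, smul_eq_mul, mul_comm (2 * T - T) K₄]
    _ ≤ D ^ 2 * (4 * K₅) / T * (K₄ * (2 * T - T) + B * (1 + 2 * T) * (1 + Real.log (2 * T)) ^ 3) := by
        gcongr
    _ = D ^ 2 * (4 * K₅ * K₄ + 4 * K₅ * B * ((1 + 2 * T) / T) * (1 + Real.log (2 * T)) ^ 3) := by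
        field_simp
        ring
    _ ≤ D ^ 2 * (4 * K₅ * K₄ + 4 * K₅ * (3 * B) * (1 + Real.log (2 * T)) ^ 3) := by
        have h3 : (1 + 2 * T) / T ≤ 3 := by rw [div_le_iff₀ hT0]; linarith
        have h4 : 4 * K₅ * B * ((1 + 2 * T) / T) ≤ 4 * K₅ * (3 * B) := by
          have := mul_le_mul_of_nonneg_left h3 (by positivity : 0 ≤ 4 * K₅ * B)
          linarith
        gcongr

/-- `A + B(1 + log 2T)³ ≤ ε T` for `T` large (`ε > 0`; `log³ x = o(x)`). [folklore] -/
theorem UniversalFactor.narrowRed_log_cube_eventually (A B : ℝ) {ε : ℝ} (hε : 0 < ε) :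
    ∃ T₁ : ℝ, ∀ T : ℝ, T₁ ≤ T → A + B * (1 + Real.log (2 * T)) ^ 3 ≤ ε * T := by
  -- `(1 + log 2T)³ / T → 0`
  have he : (0 : ℝ) < 2 * Real.exp 1 := by positivity
  have h1 : Tendsto (fun T : ℝ => Real.log (2 * Real.exp 1 * T) ^ 3 / ((2 * Real.exp 1)⁻¹ * (2 * Real.exp 1 * T) + 0))
      atTop (𝓝 0) :=
    (Real.tendsto_pow_log_div_mul_add_atTop (2 * Real.exp 1)⁻¹ 0 3 (inv_ne_zero he.ne')).comp
      (tendsto_id.const_mul_atTop he)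
  have h2 : Tendsto (fun T : ℝ => (1 + Real.log (2 * T)) ^ 3 / T) atTop (𝓝 0) := by
    refine h1.congr' ?_
    filter_upwards [eventually_gt_atTop (0 : ℝ)] with T hT
    have h3 : Real.log (2 * Real.exp 1 * T) = 1 + Real.log (2 * T) := by
      rw [show 2 * Real.exp 1 * T = Real.exp 1 * (2 * T) by ring,
        Real.log_mul (Real.exp_pos 1).ne' (by positivity), Real.log_exp]
    rw [h3, add_zero, ← mul_assoc, inv_mul_cancel₀ he.ne', one_mul]
  have h4 : Tendsto (fun T : ℝ => A / T + B * ((1 + Real.log (2 * T)) ^ 3 / T)) atTop (𝓝 (0 + B * 0)) :=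
    (tendsto_const_nhds.div_atTop tendsto_id).add (h2.const_mul B)
  rw [mul_zero, add_zero] at h4
  have h5 : ∀ᶠ T in atTop, A / T + B * ((1 + Real.log (2 * T)) ^ 3 / T) < ε :=
    (tendsto_order.1 h4).2 ε hε
  obtain ⟨T₁, hT₁⟩ := (h5.and (eventually_gt_atTop (0 : ℝ))).exists_forall_of_atTop
  refine ⟨T₁, fun T hT => ?_⟩
  obtain ⟨h6, h7⟩ := hT₁ T hT
  have h8 : A / T + B * ((1 + Real.log (2 * T)) ^ 3 / T) = (A + B * (1 + Real.log (2 * T)) ^ 3) / T := by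
    field_simp
  rw [h8, div_lt_iff₀ h7] at h6
  linarith

/-! ## Step 3: the stub -/

/-- **Stub K1a-reduction (from the clean filtered function to the weighted trace).** Given the clean
lower bound and the `ξ`-envelope facts (`E(t+u) w(t) = c₀ e^{−πu/4}(1 + O((1+|u|)/t))`, global bound on
`E`), the weighted trace `(∫ e^{−2a|u|} E(t+u) Z(t+u) du)·w(t) = c₀ g(t) + r(t)` with
`∫_T^{2T} r² = O((log T)³)` (crude mean square of `Z`), whence `∫_T^{2T} (I₀ w)² ≥ (c₀²c₁/4) T`
(`(x + y)² ≥ x²/2 − y²`). [folklore] -/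
theorem UniversalFactor.stub_narrowEnergyLowerReduction :
    (∀ a : ℝ, π / 8 < a → ∃ c₁ T₁ : ℝ, 0 < c₁ ∧ ∀ T : ℝ, T₁ ≤ T →
      c₁ * T ≤ ∫ t in T..2 * T,
        (∫ u : ℝ, Real.exp (-(2 * a * |u|)) * Real.exp (-(π * u / 4)) * hardyZ (t + u)) ^ 2) →
    ((∃ C₀ : ℝ, ∀ τ : ℝ, ‖xiGammaFactor (1 / 2 + (τ : ℂ) * I)‖ ≤
        C₀ * (1 + |τ|) ^ ((7 : ℝ) / 4) * Real.exp (-(π * |τ| / 4))) ∧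
      (∃ c₀ C T₀ : ℝ, 0 < c₀ ∧ ∀ t : ℝ, T₀ ≤ t → ∀ u : ℝ, |u| ≤ t / 2 →
        |‖xiGammaFactor (1 / 2 + ((t + u : ℝ) : ℂ) * I)‖ * (t ^ (-(7 : ℝ) / 4) * Real.exp (π * t / 4)) -
            c₀ * Real.exp (-(π * u / 4))| ≤ C * Real.exp (-(π * u / 4)) * (1 + |u|) / t)) →
    ∀ a : ℝ, π / 8 < a → ∃ c T₁ : ℝ, 0 < c ∧
    ∀ T : ℝ, T₁ ≤ T →
      c * T ≤ ∫ t in T..2 * T,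
        ((∫ u : ℝ, Real.exp (-(2 * a * |u|)) *
            ‖xiGammaFactor (1 / 2 + ((t + u : ℝ) : ℂ) * I)‖ * hardyZ (t + u)) *
          (t ^ (-(7 : ℝ) / 4) * Real.exp (π * t / 4))) ^ 2 := by
  intro hclean henv a ha
  obtain ⟨c₁, T₁, hc₁, hlow⟩ := hclean a ha
  obtain ⟨⟨C₀, hC₀⟩, ⟨c₀, C, T₀, hc₀, henv2⟩⟩ := henv
  have ha0 : 0 < a := lt_trans (by positivity) ha
  have hC₀0 : 0 ≤ C₀ := by
    have h := (norm_nonneg _).trans (hC₀ 0)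
    simpa using h
  obtain ⟨A, B, hAB⟩ := UniversalFactor.narrowRed_remainder_meanSquare ha
  set D : ℝ := max C 0 + 4 * (9 * C₀ + c₀) with hDdef
  have hD : 0 ≤ D := by have := le_max_right C 0; positivity
  obtain ⟨T₂, hT₂⟩ := UniversalFactor.narrowRed_log_cube_eventually (D ^ 2 * A) (D ^ 2 * B)
    (by positivity : 0 < c₀ ^ 2 * c₁ / 4)
  refine ⟨c₀ ^ 2 * c₁ / 4, max (max T₁ T₂) (max T₀ 1), by positivity, fun T hT => ?_⟩
  have hTT₁ : T₁ ≤ T := le_trans ((le_max_left _ _).trans (le_max_left _ _)) hT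
  have hTT₂ : T₂ ≤ T := le_trans ((le_max_right _ _).trans (le_max_left _ _)) hT
  have hTT₀ : T₀ ≤ T := le_trans ((le_max_left _ _).trans (le_max_right _ _)) hT
  have hT1 : 1 ≤ T := le_trans ((le_max_right _ _).trans (le_max_right _ _)) hT
  have hT2 : T ≤ 2 * T := by linarith
  -- the players
  set I₀ : ℝ → ℝ := fun t => ∫ u : ℝ, Real.exp (-(2 * a * |u|)) *
    ‖xiGammaFactor (1 / 2 + ((t + u : ℝ) : ℂ) * I)‖ * hardyZ (t + u) with hI₀
  set w : ℝ → ℝ := fun t => t ^ (-(7 : ℝ) / 4) * Real.exp (π * t / 4) with hw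
  set g : ℝ → ℝ := fun t => ∫ u : ℝ, KT(a, u) * hardyZ (t + u) with hg
  set r : ℝ → ℝ := fun t => I₀ t * w t - c₀ * g t with hr
  -- regularity
  have hI₀c : Continuous I₀ := UniversalFactor.narrowRed_continuous_I₀ ha0
  have hgc : Continuous g :=
    UniversalFactor.narrowRed_continuous_conv ha continuous_hardyZ UniversalFactor.narrowRed_abs_hardyZ_le
  have hwc : ContinuousOn w (Icc T (2 * T)) := by
    intro t ht
    have ht0 : 0 < t := by linarith [ht.1]
    have h1 : ContinuousAt (fun s : ℝ => s ^ (-(7 : ℝ) / 4)) t :=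
      Real.continuousAt_rpow_const _ _ (Or.inl ht0.ne')
    have h2 : ContinuousAt (fun s : ℝ => Real.exp (π * s / 4)) t := by fun_prop
    exact (h1.fun_mul h2).continuousWithinAt
  have hPc : ContinuousOn (fun t => I₀ t * w t) (Icc T (2 * T)) := hI₀c.continuousOn.fun_mul hwc
  have hrc : ContinuousOn r (Icc T (2 * T)) := hPc.fun_sub (continuousOn_const.fun_mul hgc.continuousOn)
  -- Step 1: the pointwise bound on `r`
  have hrb : ∀ t ∈ Icc T (2 * T), |r t| ≤
      D / t * ∫ u : ℝ, (1 + |u|) ^ 4 * KT(a, u) * |hardyZ (t + u)| := by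
    intro t ht
    have ht1 : 1 ≤ t := hT1.trans ht.1
    have ht0 : 0 < t := by linarith
    have htT₀ : T₀ ≤ t := hTT₀.trans ht.1
    have habsZ : ∀ τ : ℝ, |(|hardyZ τ|)| ≤ 2 * (1 + |τ|) ^ 1 := fun τ => by
      rw [abs_abs]; exact UniversalFactor.narrowRed_abs_hardyZ_le τ
    have hiZ := UniversalFactor.narrowRed_integrable_section ha (φ := fun τ => |hardyZ τ|)
      (continuous_abs.comp continuous_hardyZ) habsZ 4 t
    have hrepr : r t = ∫ u : ℝ, Real.exp (-(2 * a * |u|)) *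
        (‖xiGammaFactor (1 / 2 + ((t + u : ℝ) : ℂ) * I)‖ * (t ^ (-(7 : ℝ) / 4) * Real.exp (π * t / 4)) -
          c₀ * Real.exp (-(π * u / 4))) * hardyZ (t + u) :=
      UniversalFactor.narrowRed_remainder_eq ha c₀ t
    rw [hrepr, ← Real.norm_eq_abs, ← MeasureTheory.integral_const_mul]
    refine norm_integral_le_of_norm_le (hiZ.const_mul _) (Eventually.of_forall fun u => ?_)
    rw [Real.norm_eq_abs, abs_mul]
    calc _ ≤ D / t * ((1 + |u|) ^ 4 * KT(a, u)) * |hardyZ (t + u)| :=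
          mul_le_mul_of_nonneg_right
            (UniversalFactor.narrowRed_kernel_bound hC₀ hc₀ henv2 htT₀ ht1 u) (abs_nonneg _)
      _ = D / t * ((1 + |u|) ^ 4 * KT(a, u) * |hardyZ (t + u)|) := by ring
  -- Step 2: the mean square of `r`
  have hr2 : ∫ t in T..2 * T, r t ^ 2 ≤ c₀ ^ 2 * c₁ / 4 * T := by
    have h1 := hAB D T r hD hT1 hrc hrb
    have h2 := hT₂ T hTT₂
    calc ∫ t in T..2 * T, r t ^ 2 ≤ D ^ 2 * (A + B * (1 + Real.log (2 * T)) ^ 3) := h1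
      _ = D ^ 2 * A + D ^ 2 * B * (1 + Real.log (2 * T)) ^ 3 := by ring
      _ ≤ c₀ ^ 2 * c₁ / 4 * T := h2
  -- Step 3: `(c₀ g + r)² ≥ c₀² g²/2 − r²`, integrated
  have hg2 : c₁ * T ≤ ∫ t in T..2 * T, g t ^ 2 := hlow T hTT₁
  have hpt : ∀ t ∈ Icc T (2 * T), c₀ ^ 2 / 2 * g t ^ 2 - r t ^ 2 ≤ (I₀ t * w t) ^ 2 := by
    intro t _
    simp only [hr]
    nlinarith [sq_nonneg (2 * (I₀ t * w t) - c₀ * g t)]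
  have hg2i : IntervalIntegrable (fun t => c₀ ^ 2 / 2 * g t ^ 2) volume T (2 * T) :=
    ((hgc.fun_pow 2).intervalIntegrable _ _).const_mul _
  have hr2i : IntervalIntegrable (fun t => r t ^ 2) volume T (2 * T) :=
    (hrc.fun_pow 2).intervalIntegrable_of_Icc hT2
  have hgi : IntervalIntegrable (fun t => c₀ ^ 2 / 2 * g t ^ 2 - r t ^ 2) volume T (2 * T) :=
    hg2i.sub hr2i
  have hPi : IntervalIntegrable (fun t => (I₀ t * w t) ^ 2) volume T (2 * T) :=
    (hPc.fun_pow 2).intervalIntegrable_of_Icc hT2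
  calc c₀ ^ 2 * c₁ / 4 * T = c₀ ^ 2 / 2 * (c₁ * T) - c₀ ^ 2 * c₁ / 4 * T := by ring
    _ ≤ c₀ ^ 2 / 2 * (∫ t in T..2 * T, g t ^ 2) - ∫ t in T..2 * T, r t ^ 2 :=
        sub_le_sub (mul_le_mul_of_nonneg_left hg2 (by positivity)) hr2
    _ = ∫ t in T..2 * T, (c₀ ^ 2 / 2 * g t ^ 2 - r t ^ 2) := by
        rw [intervalIntegral.integral_sub hg2i hr2i, intervalIntegral.integral_const_mul]
    _ ≤ ∫ t in T..2 * T, (I₀ t * w t) ^ 2 := intervalIntegral.integral_mono_on hT2 hgi hPi hpt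

end Summit.RiemannHypothesis.RiemannHypothesis.Theorems
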